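import Literature.Geometry.Lorentzian.BogovskiiVectorPointwise
import HarnessLib

/-!
# Mao–Oh–Tao Lemma 2.3, classical form: (S1)(S2) and (T1)(T2) for the named operators

(trunk G08 = T-LORENTZ; family `gr`; namespace `Literature.Geometry.Lorentzian.MaoOhTao`.)

Summary file of the series `BogovskiiDoubleDivergence` … `BogovskiiVectorPointwise`: Lemma 2.3 of Mao–Oh–Tao
(arXiv:2308.13031) for the operators `S_η` (`bogovskiiS`) and `T_η` (`bogovskiiT`, corrected sign), in classical
(pointwise) form for `C²` data:

* `support_bogovskiiS_subset`, `support_bogovskiiSV_subset`, `support_bogovskiiT_subset` — **(S1), (T1)**: if `η` is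
  supported in `B` and `Ω ⊇ supp f` is star-shaped with respect to every point of `B`, then `supp S_η f ⊆ Ω` and
  `supp T_η F ⊆ closure Ω`;
* `lemma_2_3_S` — (S1) ∧ `S_η f ∈ C²` ∧ (S2) `Σ_{ij} ∂_i∂_j (S_η f)^{ij} = f`;
* `lemma_2_3_T` — (T1) ∧ symmetry ∧ `T_η F ∈ C¹` ∧ (T2) `Σ_i ∂_i (T_η F)^{ij} = F^j`.

(The mapping properties (S3)–(S4), (T3)–(T4) in Sobolev spaces are not formalized.)

## References

* Y. Mao, S.-J. Oh, T. Tao, arXiv:2308.13031 (2023), Lemma 2.3, p. 8 (key `MaoOhTao2023`).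
-/

noncomputable section

open scoped RealInnerProductSpace Topology
open Filter MeasureTheory Set Metric Function

namespace Literature.Geometry.Lorentzian

namespace MaoOhTao

variable {η : E3 → ℝ} {R : ℝ} {Ω B : Set E3}

/-- **(S1)**: `supp (S_η f)^{ij} ⊆ Ω`. [cite: MaoOhTao2023, Lemma 2.3 (S1)] -/
theorem support_bogovskiiS_subset (hΩ : ∀ b ∈ B, StarConvex ℝ b Ω) (hηB : ∀ z, η z ≠ 0 → z ∈ B) {f : E3 → ℝ}
    (hfΩ : ∀ y, f y ≠ 0 → y ∈ Ω) (i j : Fin 3) : support (bogovskiiS η f i j) ⊆ Ω :=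
  support_bogovskiiOperator_subset hΩ hηB hfΩ i j

/-- **(T1) for the vector operator**: `supp (SV_η f)^{a} ⊆ Ω`. [cite: MaoOhTao2023, Lemma 2.3 (T1)] -/
theorem support_bogovskiiSV_subset (hΩ : ∀ b ∈ B, StarConvex ℝ b Ω) (hηB : ∀ z, η z ≠ 0 → z ∈ B) {f : E3 → ℝ}
    (hfΩ : ∀ y, f y ≠ 0 → y ∈ Ω) (a : Fin 3) : support (bogovskiiSV η f a) ⊆ Ω :=
  support_bogovskiiV_operator_subset hΩ hηB hfΩ a

/-- A partial derivative of a function vanishing on an open set vanishes there. [folklore] -/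
theorem pd_eq_zero_of_forall_mem {g : E3 → ℝ} {U : Set E3} (hU : IsOpen U) (hg : ∀ x ∈ U, g x = 0) {x : E3}
    (hx : x ∈ U) (m : Fin 3) : pd m g x = 0 := by
  have hev : g =ᶠ[𝓝 x] fun _ ↦ 0 := by
    filter_upwards [hU.mem_nhds hx] with y hy
    exact hg y hy
  simp only [pd, hev.fderiv_eq, fderiv_fun_const, Pi.zero_apply]
  rfl

/-- A function with support in `Ω` vanishes on `(closure Ω)ᶜ`, and so do its partial derivatives. [folklore] -/
theorem pd_eq_zero_of_support_subset {g : E3 → ℝ} (hg : support g ⊆ Ω) {x : E3} (hx : x ∉ closure Ω)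
    (m : Fin 3) : pd m g x = 0 := by
  refine pd_eq_zero_of_forall_mem isClosed_closure.isOpen_compl (fun y hy ↦ ?_) hx m
  by_contra h
  exact hy (subset_closure (hg (mem_support.2 h)))

/-- **(T1)**: `supp (T_η F)^{ij} ⊆ closure Ω` (the tensor involves first derivatives of `S_η F_k`, which vanish on the
interior of the zero set). [cite: MaoOhTao2023, Lemma 2.3 (T1)] -/
theorem support_bogovskiiT_subset (hΩ : ∀ b ∈ B, StarConvex ℝ b Ω) (hηB : ∀ z, η z ≠ 0 → z ∈ B)
    {F : Fin 3 → E3 → ℝ} (hFΩ : ∀ k y, F k y ≠ 0 → y ∈ Ω) (i j : Fin 3) :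
    support (bogovskiiT η F i j) ⊆ closure Ω := by
  intro x hx
  by_contra hxc
  have hxΩ : x ∉ Ω := fun h ↦ hxc (subset_closure h)
  have hSV : ∀ k a, bogovskiiSV η (F k) a x = 0 := fun k a ↦ by
    by_contra h
    exact hxΩ (support_bogovskiiSV_subset hΩ hηB (hFΩ k) a (mem_support.2 h))
  have hSK : ∀ k a b m, pd m (bogovskiiS η (F k) a b) x = 0 := fun k a b m ↦
    pd_eq_zero_of_support_subset (support_bogovskiiS_subset hΩ hηB (hFΩ k) a b) hxc m
  apply hx
  simp only [bogovskiiT, hSV, hSK, add_zero, mul_zero, Finset.sum_const_zero, sub_zero]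

/-- **Lemma 2.3 for `S_η`, classical form**: for `η ∈ C²_c` supported in `B`, vanishing off `B̄_R`, with `∫ η = 1`,
`Ω` star-shaped with respect to every point of `B`, and `f ∈ C²_c` supported in `Ω` with vanishing affine moments:
(S1) `supp (S_η f)^{ij} ⊆ Ω`, `S_η f ∈ C²`, and (S2) `Σ_i Σ_j ∂_i∂_j (S_η f)^{ij} = f` pointwise.
[cite: MaoOhTao2023, Lemma 2.3 (S1)(S2)] -/
theorem lemma_2_3_S (hη : ContDiff ℝ 2 η) (hR : ∀ z : E3, R < ‖z‖ → η z = 0) (hη1 : ∫ z : E3, η z = 1)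
    (hΩ : ∀ b ∈ B, StarConvex ℝ b Ω) (hηB : ∀ z, η z ≠ 0 → z ∈ B) {f : E3 → ℝ} (hf : ContDiff ℝ 2 f)
    (hfc : HasCompactSupport f) (hfΩ : ∀ y, f y ≠ 0 → y ∈ Ω) (hmom : ∀ μ, ∫ y : E3, f y * momentFn μ y = 0) :
    (∀ i j, support (bogovskiiS η f i j) ⊆ Ω) ∧ (∀ i j, ContDiff ℝ 2 (bogovskiiS η f i j)) ∧
      ∀ x : E3, ∑ i, ∑ j, pd i (pd j (bogovskiiS η f i j)) x = f x :=
  ⟨fun i j ↦ support_bogovskiiS_subset hΩ hηB hfΩ i j, fun i j ↦ contDiff_two_bogovskiiS hη hR hf hfc i j,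
    fun x ↦ sum_sum_pd_pd_bogovskiiS_eq hη hR hη1 hf hfc hmom x⟩

/-- **Lemma 2.3 for `T_η`, classical form** (corrected sign of the kernel): for `η ∈ C²_c` supported in `B`,
vanishing off `B̄_R`, with `∫ η = 1`, `Ω` star-shaped with respect to every point of `B`, and `F ∈ C²_c` supported in
`Ω` with vanishing Killing moments: (T1) `supp (T_η F)^{ij} ⊆ closure Ω`, `T_η F` is symmetric and `C¹`, and (T2)
`Σ_i ∂_i (T_η F)^{ij} = F^j` pointwise. [cite: MaoOhTao2023, Lemma 2.3 (T1)(T2)] -/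
theorem lemma_2_3_T (hη : ContDiff ℝ 2 η) (hR : ∀ z : E3, R < ‖z‖ → η z = 0) (hη1 : ∫ z : E3, η z = 1)
    (hΩ : ∀ b ∈ B, StarConvex ℝ b Ω) (hηB : ∀ z, η z ≠ 0 → z ∈ B) {F : Fin 3 → E3 → ℝ}
    (hF : ∀ k, ContDiff ℝ 2 (F k)) (hFc : ∀ k, HasCompactSupport (F k)) (hFΩ : ∀ k y, F k y ≠ 0 → y ∈ Ω)
    (hF0 : ∀ k, ∫ y : E3, F k y = 0) (hFA : ∀ m j : Fin 3, ∫ y : E3, y m * F j y = ∫ y : E3, y j * F m y) :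
    (∀ i j, support (bogovskiiT η F i j) ⊆ closure Ω) ∧ (∀ i j x, bogovskiiT η F i j x = bogovskiiT η F j i x) ∧
      (∀ i j, ContDiff ℝ 1 (bogovskiiT η F i j)) ∧ ∀ (j : Fin 3) (x : E3), ∑ i, pd i (bogovskiiT η F i j) x = F j x :=
  ⟨fun i j ↦ support_bogovskiiT_subset hΩ hηB hFΩ i j, fun i j x ↦ bogovskiiT_symm η F i j x,
    fun i j ↦ contDiff_one_bogovskiiT hη hR hF hFc i j, fun j x ↦ sum_pd_bogovskiiT_eq hη hR hF hFc hη1 hF0 hFA j x⟩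

end MaoOhTao

end Literature.Geometry.Lorentzian

end
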